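import Summits.Ventures.PercRepro.LemmaBPlusK5Def

/-!
# Faces of `K₅`: kernel slices 4 … 7 (part B)

Each theorem is one `decide +kernel` at default heartbeats (≈ 55 s: the 1024-row table of the marking
plus ≤ 22 000 face points in sub-mask loops); generated by `tools/gen_k5.py`.
-/

namespace PercRepro

namespace Examples

open MultiGraph

/-- Slice 4: joins `u ∈ [342, 379)` of the faces of `K₅` (19953 face points). -/
theorem k5_slice_4 : k5.FacesSRange ![0, 1, 2, 3] 342 379 := by decide +kernel

/-- Slice 5: joins `u ∈ [379, 415)` of the faces of `K₅` (20880 face points). -/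
theorem k5_slice_5 : k5.FacesSRange ![0, 1, 2, 3] 379 415 := by decide +kernel

/-- Slice 6: joins `u ∈ [415, 446)` of the faces of `K₅` (21087 face points). -/
theorem k5_slice_6 : k5.FacesSRange ![0, 1, 2, 3] 415 446 := by decide +kernel

/-- Slice 7: joins `u ∈ [446, 474)` of the faces of `K₅` (21816 face points). -/
theorem k5_slice_7 : k5.FacesSRange ![0, 1, 2, 3] 446 474 := by decide +kernel

end Examples

end PercRepro
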